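import Literature.RepresentationTheory.HeisenbergGroup.SchwartzBruhatQuadricUncertainty
import HarnessLib

/-!
# Quadric-supported functionals whose partial Fourier transform is a multiple of themselves vanish
# (IV-4(c1) piece P6 of the Hodge/COR-CM cell, part 3: the shape consumed by the assembly P7)

Topic `RepresentationTheory/HeisenbergGroup`; namespace `Literature.RepresentationTheory.HeisenbergGroup`.  KERNEL ONLY:
theorems; no definition, no named fact, no record, no `sorry`.  Sequel of `SchwartzBruhatQuadricSupport.lean` /
`SchwartzBruhatQuadricUncertainty.lean` (§1–§6 there).

In the support-form proof of [Liu2021, Lem. D.1 (3)] (`rankOne_theta_lines_disjoint`, KEY pieces P1–P7) the functional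
`D = Λ ∘ M₀⁻¹` on the doubled oscillator `𝒮(F_v⁶) = 𝒮(F_v⁴ × F_v²)` is (i) an eigenfunctional of every multiplication by the
second-degree character `ψ_v(b·Q'(x'))` of the conjugated root subgroup (`Q'` an ANISOTROPIC quaternary form — the point where
`¬SameClass` enters), and (ii) its partial Fourier transform `D ∘ ℱ` (`ℱ = ℱ_{x'} ⊠ 1` implements `g₀ w₀ g₀⁻¹` for an element
`w₀ ∈ U(V)(F_v)`, under which `Λ` is already quasi-invariant) is a SCALAR MULTIPLE of `D`.  Then the second eigen-hypothesis of
§5 is automatic (`Q₂ = Q`, same `κ_b`) and `D = 0`: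

* §7 `eq_zero_of_quadric_eigen_of_partialFourier_eq_smul` (for `Q` continuous with bounded and thin level sets) and
  `eq_zero_of_quadraticForm_eigen_of_partialFourier_eq_smul` (for a Mathlib `QuadraticForm K (ι₁ → K)`, anisotropic,
  continuous, `ι₁ ≠ ∅` — level sets bounded/thin by §6).

## References
* [MoeglinVignerasWaldspurger1987] C. Mœglin, M.-F. Vignéras, J.-L. Waldspurger, LNM 1291 (1987), Chap. 1 I.11, Chap. 2 II.6–II.7.
* [WeilBNT1967] A. Weil, *Basic Number Theory* (1967), Chap. VII §2 Prop. 2, Cor. 1.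
* [Liu2021] Y. Liu, Camb. J. Math. 9 (2021), App. D Lemma D.1 (3) — the consumer.
-/

set_option autoImplicit false

noncomputable section

open MeasureTheory Filter
open scoped NNReal Topology Pointwise
open Literature.NumberTheory.Automorphic
open Literature.NumberTheory.GaloisRepresentations.IsNonarchimedeanLocalField

namespace Literature.RepresentationTheory.HeisenbergGroup

/-! ## §7 The cell's case: the partial Fourier transform of `D` is a multiple of `D` -/

section SelfDual

variable {K : Type*} [Field K] [ValuativeRel K] [TopologicalSpace K] [IsNonarchimedeanLocalField K]
  {ι₁ ι₂ ι : Type*} [Fintype ι₁] [Fintype ι₂] [Fintype ι] (e : ι₁ ⊕ ι₂ ≃ ι)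
  [MeasurableSpace (ι₁ → K)] [BorelSpace (ι₁ → K)] (μ₁ : Measure (ι₁ → K)) [μ₁.IsAddHaarMeasure]
  {ψ : AddChar K Circle} (hψ : ψ.IsContinuousNontrivial) {m : ℤ} (hm : ψ.HasConductorExp m)

include hm in
/-- **Variant consumed by the cell when `D ∘ ℱ = λ·D`.**  In the support-form proof of `rankOne_theta_lines_disjoint` the
partial Fourier transform `ℱ` implements `g₀ w₀ g₀⁻¹` for an element `w₀` of `U(V)(F_v)` itself, under whose doubled action the
functional `Λ` of P1 is ALREADY quasi-invariant; hence `D ∘ ℱ` is a scalar multiple of `D = Λ ∘ M₀⁻¹` and the second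
eigen-hypothesis of §5 holds with `Q₂ = Q` and the same `κ_b`.  So: `Q` continuous with BOUNDED and THIN level sets, `D` eigen
under every `ψ(b·Q(x'))`, and `D(ℱ Φ) = λ·D(Φ)` for all `Φ` ⟹ `D = 0`.
[cite: MoeglinVignerasWaldspurger1987, Chap. 2 II.6–II.7] [cite: WeilBNT1967, Chap. VII §2, Prop. 2, Cor. 1] -/
theorem eq_zero_of_quadric_eigen_of_partialFourier_eq_smul (Q : (ι₁ → K) → K) (hQ : Continuous Q)
    (hQb : ∀ c : K, ∃ M : ℤ, ∀ x', Q x' = c → x' ∈ piPrimePowBall K ι₁ M)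
    (hQi : ∀ c : K, interior {x' : ι₁ → K | Q x' = c} = ∅)
    (D : SchwartzBruhat (ι → K) →ₗ[ℂ] ℂ)
    (hD : ∀ b : K, ∃ κ : ℂ, ∀ Φ Ψ : SchwartzBruhat (ι → K),
      (∀ x, (Ψ : (ι → K) → ℂ) x = ((ψ (b * Q (resL e x)) : Circle) : ℂ) * (Φ : (ι → K) → ℂ) x) → D Ψ = κ * D Φ)
    (hF : ∃ lam : ℂ, ∀ Φ : SchwartzBruhat (ι → K),
      D (sumEndSB K e (piFourierEquivSB μ₁ hψ hm).toLinearMap LinearMap.id Φ) = lam * D Φ) :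
    D = 0 := by
  obtain ⟨lam, hlam⟩ := hF
  refine eq_zero_of_quadric_eigen_of_partialFourier_quadric_eigen e μ₁ hψ hm Q Q hQ hQ hQb hQi D hD fun b => ?_
  obtain ⟨κ, hκ⟩ := hD b
  refine ⟨κ, fun Φ Ψ h => ?_⟩
  rw [hlam, hlam, hκ Φ Ψ h]
  ring

include hm in
/-- **The same for an ANISOTROPIC QUADRATIC FORM `Q` on `K^{ι₁}`, `ι₁ ≠ ∅`** (bounded and thin level sets by §6): a linear
functional on `𝒮(K^{ι₁} × K^{ι₂})` which is an eigenfunctional of every multiplication by `ψ(b·Q(x'))` and whose partial Fourier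
transform in `x'` is a multiple of itself VANISHES.  This is the exact shape the assembly of `rankOne_theta_lines_disjoint_holds`
(piece P7) consumes, with `Q` the anisotropic quaternary second-degree character of the root subgroup.
[cite: MoeglinVignerasWaldspurger1987, Chap. 1 I.11, Chap. 2 II.6–II.7] [cite: WeilBNT1967, Chap. VII §2, Prop. 2, Cor. 1] -/
theorem eq_zero_of_quadraticForm_eigen_of_partialFourier_eq_smul [Nonempty ι₁] (Q : QuadraticForm K (ι₁ → K))
    (hQa : Q.Anisotropic) (hQc : Continuous Q) (D : SchwartzBruhat (ι → K) →ₗ[ℂ] ℂ)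
    (hD : ∀ b : K, ∃ κ : ℂ, ∀ Φ Ψ : SchwartzBruhat (ι → K),
      (∀ x, (Ψ : (ι → K) → ℂ) x = ((ψ (b * Q (resL e x)) : Circle) : ℂ) * (Φ : (ι → K) → ℂ) x) → D Ψ = κ * D Φ)
    (hF : ∃ lam : ℂ, ∀ Φ : SchwartzBruhat (ι → K),
      D (sumEndSB K e (piFourierEquivSB μ₁ hψ hm).toLinearMap LinearMap.id Φ) = lam * D Φ) :
    D = 0 :=
  eq_zero_of_quadric_eigen_of_partialFourier_eq_smul e μ₁ hψ hm Q hQc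
    (QuadraticMap.levelSet_subset_piPrimePowBall_of_anisotropic Q hQa hQc)
    (QuadraticMap.interior_levelSet_eq_empty_of_anisotropic Q hQa) D hD hF

end SelfDual

end Literature.RepresentationTheory.HeisenbergGroup

end
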